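import Literature.NumberTheory.LFunctions.ZetaZeroGapsRHGoldstonGonek
import Literature.NumberTheory.LFunctions.ZetaZeroWindowsExplicit
import Mathlib.Analysis.Real.Pi.Bounds
import Mathlib.Analysis.Complex.ExponentialBounds
import HarnessLib

/-!
# RH-CONDITIONAL — Goldston–Gonek's Theorem 1 (zeros in short intervals `(t, t+h]`, `h ≤ √t`, error `(½ + o(1)) log t/log log t` on RH) PROVED from the Carneiro–Chandee–Milinovich bound («nothing here bears on the truth of RH»)

Topic `Literature/NumberTheory/LFunctions` (RH literature-typing tranche 1, L4 "explicit zero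
statistics"; companion of `ZetaZeroGapsRHGoldstonGonek.lean`, where Goldston–Gonek's Theorem 1 is
the NAMED FACT `Literature.NumberTheory.LFunctions.GoldstonGonek2007_thm1`).  Label:
**RH-CONDITIONAL** — everything in this file is a THEOREM; RH and the published pointwise bound of
Carneiro–Chandee–Milinovich (`Literature.NumberTheory.LFunctions.CarneiroChandeeMilinovich2013_thm1`,
a named fact of `ZetaArgRHExtremalBounds.lean`) enter as explicit hypotheses.  No named fact and no
definition is introduced; the net effect is that the fact `GoldstonGonek2007_thm1` is now a
CONSEQUENCE of `CarneiroChandeeMilinovich2013_thm1` (`GoldstonGonek2007_thm1_of_CCM`).  Nothing is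
asserted about RH; nothing here bears on the truth of RH.

Source: D. A. Goldston, S. M. Gonek, *A note on `S(t)` and the zeros of the Riemann zeta-function*,
Bull. Lond. Math. Soc. **39** (2007) 482–486 (arXiv:math/0511092), Theorem 1: "Assume the Riemann
Hypothesis. Let `t` be large and `0 < h ≤ √t`. Then
`|N(t+h) − N(t) − (h/2π) log(t/2π)| ≤ (½ + o(1)) log t/log log t`."  Goldston–Gonek prove it
directly (Guinand–Weil with Beurling–Selberg majorants) and DEDUCE the pointwise
`|S(t)| ≤ (½ + o(1)) log t/log log t` (their Theorem 2).  Conversely, any eventual pointwise bound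
`|S(t)| ≤ (c₀ + o(1)) log t/log log t` gives the short-interval statement with `2c₀ + o(1)`
uniformly in `0 < h ≤ √t`, because
`N(t+h) − N(t) = L(t+h) − L(t) + S(t+h) − S(t) + O(1/t)`,
`0 ≤ L(t+h) − L(t) − (h/2π) log(t/2π) ≤ h²/(2πt) ≤ 1/2π`, and
`log(t+h)/log log(t+h) ≤ log t/log log t + h/(t log log t) ≤ log t/log log t + 1`; with
Carneiro–Chandee–Milinovich's `c₀ = ¼` this is exactly Theorem 1 (`2c₀ = ½`).

* `Literature.NumberTheory.LFunctions.GoldstonGonek2007.shortInterval_of_S_bound` — the RH-free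
  implication `(c₀ + o(1))`-bound for `S` ⇒ `(2c₀ + o(1))`-short-interval count, with the explicit
  threshold `t ≥ max(t₁, 21, exp(4K²))`, `K = (2/ε)(c₀ + ε/4 + 0.2)` hidden in the `∃ t₀`.
* `Literature.NumberTheory.LFunctions.CarneiroChandeeMilinovich2013_thm1.goldstonGonek_thm1`,
  `Literature.NumberTheory.LFunctions.GoldstonGonek2007_thm1_of_CCM` —
  **`CarneiroChandeeMilinovich2013_thm1 → GoldstonGonek2007_thm1`**.

Inputs (all proved in the tree): `Literature.NumberTheory.LFunctions.ZetaZeroWindows.count_diff_le`,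
`Literature.NumberTheory.LFunctions.Simonic2022Lemma6.count_diff_ge` with the remainder
`Literature.NumberTheory.LFunctions.abs_count_sub_countMain_sub_zetaArgS_le`,
`Literature.NumberTheory.LFunctions.Simonic2022Lemma6.log_div_loglog_add_le`.

## References

* D. A. Goldston, S. M. Gonek, Bull. Lond. Math. Soc. 39 (2007) 482–486, Thm. 1
  (arXiv:math/0511092). [GoldstonGonek2007]
* E. Carneiro, V. Chandee, M. B. Milinovich, Math. Ann. 356 (2013) 939–968, Thm. 1.
  [CarneiroChandeeMilinovich2013]
-/

noncomputable section

open Real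

namespace Literature.NumberTheory.LFunctions

open SchoenfeldBound

namespace GoldstonGonek2007

/-- `√(log t)/2 ≤ log t/log log t` for `t > e` (`log x ≤ 2√x` for `x > 0`).
[cite: GoldstonGonek2007, §1 Thm. 1] -/
private theorem sqrt_log_div_two_le {t : ℝ} (ht : Real.exp 1 < t) :
    Real.sqrt (Real.log t) / 2 ≤ Real.log t / Real.log (Real.log t) := by
  have ht0 : 0 < t := lt_trans (Real.exp_pos _) ht
  have hx : 1 < Real.log t := by rw [Real.lt_log_iff_exp_lt ht0]; exact ht
  set x := Real.log t with hxdef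
  have hx0 : 0 < x := by linarith
  have hll : 0 < Real.log x := Real.log_pos hx
  have hs0 : 0 < Real.sqrt x := Real.sqrt_pos.2 hx0
  have h1 : Real.log (Real.sqrt x) ≤ Real.sqrt x - 1 := Real.log_le_sub_one_of_pos hs0
  have h2 : Real.log x = 2 * Real.log (Real.sqrt x) := by
    rw [Real.log_sqrt hx0.le]; ring
  have h3 : Real.log x ≤ 2 * Real.sqrt x := by linarith
  rw [le_div_iff₀ hll]
  have h4 := Real.mul_self_sqrt hx0.le
  nlinarith

/-- `K ≤ log t/log log t` as soon as `t > e` and `t ≥ exp(4K²)` (`K ≥ 0`).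
[cite: GoldstonGonek2007, §1 Thm. 1] -/
private theorem le_log_div_loglog {K t : ℝ} (hK : 0 ≤ K) (ht : Real.exp 1 < t)
    (hKt : Real.exp (4 * K ^ 2) ≤ t) : K ≤ Real.log t / Real.log (Real.log t) := by
  have ht0 : 0 < t := lt_trans (Real.exp_pos _) ht
  have h1 : 4 * K ^ 2 ≤ Real.log t := by rw [Real.le_log_iff_exp_le ht0]; exact hKt
  have h2 : 2 * K ≤ Real.sqrt (Real.log t) := by
    rw [show 2 * K = Real.sqrt ((2 * K) ^ 2) by rw [Real.sqrt_sq (by linarith)]]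
    exact Real.sqrt_le_sqrt (by linarith)
  linarith [sqrt_log_div_two_le ht]

/-- `e^e ≤ 21`. [cite: GoldstonGonek2007, §1 Thm. 1] -/
private theorem exp_exp_one_le : Real.exp (Real.exp 1) ≤ 21 := by
  have he := Real.exp_one_lt_d9
  have he0 := Real.exp_pos 1
  calc Real.exp (Real.exp 1) ≤ Real.exp 3 := Real.exp_le_exp.2 (by linarith)
    _ = Real.exp 1 ^ 3 := by rw [Real.exp_one_pow]; norm_num
    _ ≤ 2.7182818286 ^ 3 := by gcongr
    _ ≤ 21 := by norm_num

set_option maxHeartbeats 400000 in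
/-- **Short-interval zero counts from an eventual pointwise bound on `S(t)`** (RH-free
implication): if for every `ε > 0` eventually `|S(t)| ≤ (c₀ + ε) log t/log log t`, then for every
`ε > 0`, for all large `t` and all `0 < h ≤ √t`,
`|N(t+h) − N(t) − (h/2π) log(t/2π)| ≤ (2c₀ + ε) log t/log log t`.
(`N(t+h) − N(t) − (L(t+h) − L(t)) = S(t+h) − S(t) + O(2.4/(πt))`;
`0 ≤ L(t+h) − L(t) − (h/2π) log(t/2π) ≤ h²/(2πt) ≤ 1/2π`;
`log(t+h)/log log(t+h) ≤ log t/log log t + 1`; the bounded terms are absorbed by `(ε/2) log t/log log t`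
for `t ≥ exp(4K²)`.) [cite: GoldstonGonek2007, §1 Thm. 1] -/
theorem shortInterval_of_S_bound {c₀ : ℝ} (hc₀ : 0 ≤ c₀)
    (hS : ∀ ε : ℝ, 0 < ε → ∃ t₁ : ℝ, ∀ t : ℝ, t₁ ≤ t →
      |zetaArgS t| ≤ (c₀ + ε) * Real.log t / Real.log (Real.log t))
    {ε : ℝ} (hε : 0 < ε) :
    ∃ t₀ : ℝ, ∀ t : ℝ, t₀ ≤ t → ∀ h : ℝ, 0 < h → h ≤ Real.sqrt t →
      |((zetaZeroCount (t + h) : ℝ) - zetaZeroCount t) - h / (2 * π) * Real.log (t / (2 * π))| ≤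
        (2 * c₀ + ε) * Real.log t / Real.log (Real.log t) := by
  obtain ⟨t₁, ht₁⟩ := hS (ε / 4) (by positivity)
  set K : ℝ := 2 / ε * (c₀ + ε / 4 + 0.2) with hK
  have hK0 : 0 ≤ K := by positivity
  have hKε : ε / 2 * K = c₀ + ε / 4 + 0.2 := by
    rw [hK]; field_simp
  refine ⟨max t₁ (max 21 (Real.exp (4 * K ^ 2))), fun t ht h hh hht ↦ ?_⟩
  have h₁ : t₁ ≤ t := le_trans (le_max_left _ _) ht
  have h21 : 21 ≤ t := le_trans ((le_max_left _ _).trans (le_max_right _ _)) ht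
  have hKt : Real.exp (4 * K ^ 2) ≤ t := le_trans ((le_max_right _ _).trans (le_max_right _ _)) ht
  have hπ := Real.pi_pos
  have hπ3 := Real.pi_gt_d2
  have he := Real.exp_one_lt_d9
  have he' := Real.exp_one_gt_d9
  have hee := exp_exp_one_le
  have ht0 : 0 < t := by linarith
  have hte : Real.exp 1 < t := by linarith
  set f : ℝ := Real.log t / Real.log (Real.log t) with hf
  have hfK : K ≤ f := le_log_div_loglog hK0 hte hKt
  -- `log log t ≥ 1`
  have hlt : Real.exp 1 ≤ Real.log t := by
    rw [Real.le_log_iff_exp_le ht0]; linarith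
  have hll1 : 1 ≤ Real.log (Real.log t) := by
    rw [Real.le_log_iff_exp_le (by linarith)]; exact hlt
  have hf0 : 0 ≤ f := div_nonneg (by linarith) (by linarith)
  -- `h ≤ √t ≤ t`, `h² ≤ t`
  have hh2 : h ^ 2 ≤ t := by
    calc h ^ 2 ≤ Real.sqrt t ^ 2 := by gcongr
      _ = t := Real.sq_sqrt ht0.le
  have hht' : h ≤ t := by nlinarith
  -- the two `S` values
  have hS0 : |zetaArgS t| ≤ (c₀ + ε / 4) * f := by
    have := ht₁ t h₁; rwa [mul_div_assoc] at this
  have hfadd : Real.log (t + h) / Real.log (Real.log (t + h)) ≤ f + 1 := by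
    have h1 := Simonic2022Lemma6.log_div_loglog_add_le hte hh.le
    have h2 : h / (t * Real.log (Real.log t)) ≤ 1 := by
      rw [div_le_one (by positivity)]
      nlinarith
    linarith
  have hS1 : |zetaArgS (t + h)| ≤ (c₀ + ε / 4) * (f + 1) := by
    have := ht₁ (t + h) (by linarith)
    rw [mul_div_assoc] at this
    exact this.trans (mul_le_mul_of_nonneg_left hfadd (by positivity))
  -- remainder `2.4/(πt) ≤ 0.04`
  have hrem : 2.4 / (π * t) ≤ 0.04 := by
    rw [div_le_iff₀ (by positivity)]; nlinarith
  -- upper bound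
  have hU := ZetaZeroWindows.count_diff_le (T := t) (H := h) (by linarith) hh.le
  have hΔ := ZetaZeroWindows.mul_log_sub_log_le (T := t) (H := h) ht0 hh.le
  have hq : h / (2 * π) * Real.log ((t + h) / (2 * π)) - h / (2 * π) * Real.log (t / (2 * π)) ≤
      0.16 := by
    have hΔ' : Real.log ((t + h) / (2 * π)) - Real.log (t / (2 * π)) ≤ h / t := by
      rw [le_div_iff₀ ht0]; linarith
    have h1 : h / (2 * π) * (Real.log ((t + h) / (2 * π)) - Real.log (t / (2 * π))) ≤
        h / (2 * π) * (h / t) := mul_le_mul_of_nonneg_left hΔ' (by positivity)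
    have h2 : h / (2 * π) * (h / t) = h ^ 2 / t / (2 * π) := by
      field_simp
    have h3 : h ^ 2 / t ≤ 1 := by rw [div_le_one ht0]; exact hh2
    have h4 : h ^ 2 / t / (2 * π) ≤ 1 / (2 * π) := by gcongr
    have h5 : 1 / (2 * π) ≤ 0.16 := by
      rw [div_le_iff₀ (by positivity)]; nlinarith
    linarith
  -- lower bound
  have hL := Simonic2022Lemma6.count_diff_ge (A := 1.2 / π) (t₁ := 2) (T := t) (H := h) two_pos
    (fun s hs ↦ abs_count_sub_countMain_sub_zetaArgS_le hs) (by linarith) hh.le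
  have hrem' : 2 * (1.2 / π) / t = 2.4 / (π * t) := by
    field_simp; ring
  rw [hrem'] at hL
  -- absorb the bounded terms
  have habs : c₀ + ε / 4 + 0.2 ≤ ε / 2 * f := by
    rw [← hKε]; exact mul_le_mul_of_nonneg_left hfK (by positivity)
  have hS1' : |zetaArgS (t + h)| ≤ (c₀ + ε / 4) * f + (c₀ + ε / 4) := by linarith
  have hlo : -((2 * c₀ + ε) * f) ≤
      ((zetaZeroCount (t + h) : ℝ) - zetaZeroCount t) - h / (2 * π) * Real.log (t / (2 * π)) := by
    linarith
  have hhi : ((zetaZeroCount (t + h) : ℝ) - zetaZeroCount t) - h / (2 * π) * Real.log (t / (2 * π)) ≤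
      (2 * c₀ + ε) * f := by
    linarith
  rw [mul_div_assoc, abs_le]
  exact ⟨hlo, hhi⟩

end GoldstonGonek2007

/-- **Goldston–Gonek's Theorem 1 from Carneiro–Chandee–Milinovich's Theorem 1**
(`c₀ = ¼`, `2c₀ = ½`). [cite: GoldstonGonek2007, §1 Thm. 1] -/
theorem CarneiroChandeeMilinovich2013_thm1.goldstonGonek_thm1
    (h : CarneiroChandeeMilinovich2013_thm1) : GoldstonGonek2007_thm1 := by
  intro hRH ε hε
  have hS : ∀ ε : ℝ, 0 < ε → ∃ t₁ : ℝ, ∀ t : ℝ, t₁ ≤ t →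
      |zetaArgS t| ≤ (1 / 4 + ε) * Real.log t / Real.log (Real.log t) :=
    fun ε hε ↦ h.littlewood hRH hε
  have hm := GoldstonGonek2007.shortInterval_of_S_bound (c₀ := 1 / 4) (by norm_num) hS hε
  have e : (2 * (1 / 4 : ℝ) + ε) = 1 / 2 + ε := by norm_num
  rwa [e] at hm

/-- `CarneiroChandeeMilinovich2013_thm1 → GoldstonGonek2007_thm1` (top-level name).
[cite: GoldstonGonek2007, §1 Thm. 1] -/
theorem GoldstonGonek2007_thm1_of_CCM (h : CarneiroChandeeMilinovich2013_thm1) :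
    GoldstonGonek2007_thm1 :=
  h.goldstonGonek_thm1

end Literature.NumberTheory.LFunctions

end
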